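import Mathlib

/-!
# The place `(p)` of `ℚ` for a rational prime `p`, and places above it

Tier-5 support N3 / §G-N4.2 (seat p3, gen 87). The lattice-model statement of §N3.10.3 (file 331) is read at a place
`vp` of `ℚ` (the additive character `ψ` lives on `ℚ_p = vp.adicCompletion ℚ`) and a place `v` of `K⁺` above it. The
record has the place `(3)` of `ℚ` (seat p8's `T5InertPrimeToy.vThree`) only; this file constructs the place `(p)` of
`ℚ` for EVERY rational prime `p`, as an element of Mathlib's `HeightOneSpectrum (𝓞 ℚ)`, and proves the two facts the
joint statements need:

* **`vRat p`** — the height-one prime `(p) ⊂ 𝓞_ℚ` (`prime_natCast_ringOfIntegersRat`: `p` is a prime element of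
  `𝓞_ℚ`, through Mathlib's `Rat.ringOfIntegersEquiv : 𝓞 ℚ ≃+* ℤ` and `MulEquiv.prime_iff`);
* **`liesOver_vRat_of_mem`** — every place `v` of a number field `F` with `p ∈ v` lies over `vRat p` (the
  contraction of `v` is a prime containing the maximal ideal `(p)`);
* **`notMem_of_mem_of_coprime`** — a prime ideal containing `m` does not contain `n` when `m` and `n` are coprime
  natural numbers (Bézout); `notMem_of_mem_of_prime_of_not_dvd` for `m` a prime not dividing `n`;
* `vRat_three_eq_vThree`-type identifications are left to the consumer (`HeightOneSpectrum.ext` on the ideals).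

§8(d): uses an L-value-free non-vanishing device: NO.
-/

open IsDedekindDomain IsDedekindDomain.HeightOneSpectrum NumberField

namespace Summit.Ventures.HodgeRepro2.T5RationalPlace

section Prime

variable (p : ℕ) [hp : Fact p.Prime]

/-- `p` is a prime element of `𝓞_ℚ` (through `Rat.ringOfIntegersEquiv : 𝓞 ℚ ≃+* ℤ`). -/
theorem prime_natCast_ringOfIntegersRat : Prime (p : 𝓞 ℚ) := by
  have h : Prime (Rat.ringOfIntegersEquiv (p : 𝓞 ℚ)) := by
    rw [map_natCast]
    exact Nat.prime_iff_prime_int.mp hp.out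
  exact (MulEquiv.prime_iff Rat.ringOfIntegersEquiv.toMulEquiv).mp h

/-- `p ≠ 0` in `𝓞_ℚ`. -/
theorem natCast_ne_zero_ringOfIntegersRat : (p : 𝓞 ℚ) ≠ 0 := Nat.cast_ne_zero.mpr hp.out.ne_zero

/-- `(p)` is a prime ideal of `𝓞_ℚ`. -/
theorem isPrime_span_natCast_ringOfIntegersRat : (Ideal.span {(p : 𝓞 ℚ)}).IsPrime :=
  (Ideal.span_singleton_prime (natCast_ne_zero_ringOfIntegersRat p)).mpr (prime_natCast_ringOfIntegersRat p)

/-- **The place `(p)` of `ℚ`** for a rational prime `p`. -/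
noncomputable def vRat : HeightOneSpectrum (𝓞 ℚ) where
  asIdeal := Ideal.span {(p : 𝓞 ℚ)}
  isPrime := isPrime_span_natCast_ringOfIntegersRat p
  ne_bot := Ideal.span_singleton_eq_bot.not.mpr (natCast_ne_zero_ringOfIntegersRat p)

/-- The ideal of `vRat p` is `(p)`. -/
theorem vRat_asIdeal : (vRat p).asIdeal = Ideal.span {(p : 𝓞 ℚ)} := rfl

/-- `p ∈ vRat p`. -/
theorem natCast_mem_vRat : (p : 𝓞 ℚ) ∈ (vRat p).asIdeal := Ideal.mem_span_singleton_self _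

/-- `(p)` is a maximal ideal of `𝓞_ℚ` (a non-zero prime of a Dedekind domain). -/
theorem isMaximal_asIdeal_vRat : (vRat p).asIdeal.IsMaximal :=
  (vRat p).isPrime.isMaximal (vRat p).ne_bot

end Prime

section Above

variable (p : ℕ) [hp : Fact p.Prime]
variable {F : Type*} [Field F] [NumberField F]

/-- **Every place `v` of a number field `F` with `p ∈ v` lies over `vRat p`**: the contraction of `v` to `𝓞_ℚ` is a
proper prime ideal containing the maximal ideal `(p)`, hence equal to it. -/
theorem liesOver_vRat_of_mem (v : HeightOneSpectrum (𝓞 F)) (h : (p : 𝓞 F) ∈ v.asIdeal) :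
    v.asIdeal.LiesOver (vRat p).asIdeal := by
  refine ⟨?_⟩
  have hle : (vRat p).asIdeal ≤ v.asIdeal.under (𝓞 ℚ) := by
    rw [vRat_asIdeal, Ideal.span_le, Set.singleton_subset_iff, SetLike.mem_coe, Ideal.mem_under, map_natCast]
    exact h
  exact (isMaximal_asIdeal_vRat p).eq_of_le (Ideal.IsPrime.comap _).ne_top hle

end Above

section Coprime

variable {R : Type*} [CommRing R]

/-- A proper ideal containing a natural number `m` does not contain any natural number `n` coprime to `m` (Bézout:
`a m + b n = 1` would put `1` in the ideal). -/
theorem notMem_of_mem_of_coprime (I : Ideal R) (hI : I ≠ ⊤) {m n : ℕ} (hmn : Nat.Coprime m n)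
    (hm : (m : R) ∈ I) : (n : R) ∉ I := by
  intro hn
  have hcop : IsCoprime (m : R) (n : R) := by
    have h := (Nat.isCoprime_iff_coprime.mpr hmn).map (algebraMap ℤ R)
    simpa using h
  obtain ⟨a, b, hab⟩ := hcop
  have h1 : (1 : R) ∈ I := by
    rw [← hab]
    exact I.add_mem (I.mul_mem_left a hm) (I.mul_mem_left b hn)
  exact hI ((Ideal.eq_top_iff_one _).mpr h1)

/-- A proper ideal containing a prime `p` does not contain a natural number `n` with `p ∤ n`. -/
theorem notMem_of_mem_of_prime_of_not_dvd (I : Ideal R) (hI : I ≠ ⊤) {p n : ℕ} (hp : p.Prime) (hpn : ¬ p ∣ n)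
    (hm : (p : R) ∈ I) : (n : R) ∉ I :=
  notMem_of_mem_of_coprime I hI ((Nat.Prime.coprime_iff_not_dvd hp).mpr hpn) hm

end Coprime

end Summit.Ventures.HodgeRepro2.T5RationalPlace
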